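import Summits.RiemannHypothesis.RiemannHypothesis.Theorems.WeilGroundStateGroundStatesConvergeToXiEvenWitnessParity
import Literature.NumberTheory.LFunctions.WeilWindowSimpleEven
import Literature.NumberTheory.LFunctions.WeilWindowSuzukiContinuityProofs
import Literature.NumberTheory.LFunctions.WeilMellinBounds
import Literature.NumberTheory.LFunctions.WeilGroundState
import HarnessLib

/-!
# Stub `stub_energyCauchy` of the line `Sketch`
(crux `WeilGroundState.GroundStatesConvergeToXi`, item stmt-RiemannHypothesis-1527, rev L8, wave 1 / W3)

**Minimising sequences of a Weil ground state are Cauchy in energy.**  If `gₙ` are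
`L²`-normalised window test functions (`tsupport gₙ ⊆ [-a, a]`, `∫‖gₙ‖² = 1`) with
`Re Q(gₙ) → ε(a) = weilGroundEnergy a` and `gₙ → u` in `L²`, then `Re Q(gₙ − gₘ) → 0` as
`n, m → ∞` (along `atTop` on `ℕ × ℕ`).

Proof (the standard fact that minimising sequences of a closed-below quadratic form converge in
form norm):
1. *Parallelogram law* for Weil's quadratic functional on test functions,
   `Q(g + h) + Q(g − h) = 2Q(g) + 2Q(h)` (`weilQuadratic_add` at `(g, h)` and `(g, −h)`; the cross
   terms change sign, `Q(−h) = Q(h)`).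
2. `∫‖gₙ + gₘ‖² + ∫‖gₙ − gₘ‖² = 4` (pointwise parallelogram law in `ℂ`) and
   `‖gₙ − gₘ‖₂ ≤ ‖gₙ − u‖₂ + ‖gₘ − u‖₂ → 0` (Minkowski, `sqrt_integral_norm_sq_sub_le`).
3. The Rayleigh bounds `ε ∫‖gₙ ± gₘ‖² ≤ Re Q(gₙ ± gₘ)`
   (`weilGroundEnergy_mul_integral_norm_sq_le`) squeeze:
   `ε ∫‖gₙ − gₘ‖² ≤ Re Q(gₙ − gₘ) = 2Re Q(gₙ) + 2Re Q(gₘ) − Re Q(gₙ + gₘ)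
     ≤ 2Re Q(gₙ) + 2Re Q(gₘ) − ε(4 − ∫‖gₙ − gₘ‖²) → 2ε + 2ε − 4ε = 0`.

Mathlib + proved tree material only; no named fact; no definitions; standard axioms.
-/

set_option linter.dupNamespace false

noncomputable section

open MeasureTheory Complex Filter Set
open scoped Real Topology ComplexConjugate

namespace Summit.RiemannHypothesis.RiemannHypothesis.Theorems.GroundStatesConvergeToXi

open Literature.NumberTheory.LFunctions

/-! ### The parallelogram law for Weil's quadratic functional -/

/-- **Parallelogram law for `Q`** on test functions: `Q(g + h) + Q(g − h) = 2Q(g) + 2Q(h)`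
(polarisation `weilQuadratic_add` at `(g, h)` and at `(g, −h)`: `Q(−h) = Q(h)` and the cross terms
`W(g ⋆ h̃)`, `W(h ⋆ g̃)` change sign). [folklore] -/
theorem energyCauchy_weilQuadratic_add_add_sub {g h : ℝ → ℂ} (hg : IsWeilTest g)
    (hh : IsWeilTest h) :
    weilQuadratic (g + h) + weilQuadratic (g - h) = 2 * weilQuadratic g + 2 * weilQuadratic h := by
  have hneg : IsWeilTest (fun t ↦ (-1 : ℂ) * h t) := hh.const_mul (-1)
  have e : g - h = g + fun t ↦ (-1 : ℂ) * h t := by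
    funext t
    simp [sub_eq_add_neg]
  have h1 := weilQuadratic_add hg hh
  have h2 := weilQuadratic_add hg hneg
  rw [← e] at h2
  have hQn : weilQuadratic (fun t ↦ (-1 : ℂ) * h t) = weilQuadratic h := by
    rw [weilQuadratic_const_mul]
    simp
  have hRn : weilReflect (fun t ↦ (-1 : ℂ) * h t) = fun t ↦ (-1 : ℂ) * weilReflect h t := by
    rw [weilReflect_const_mul]
    simp
  have hc1 : weilFunctional (weilConv g (weilReflect fun t ↦ (-1 : ℂ) * h t)) =
      -weilFunctional (weilConv g (weilReflect h)) := by
    rw [hRn, weilConv_const_mul_right, weilFunctional_const_mul]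
    ring
  have hc2 : weilFunctional (weilConv (fun t ↦ (-1 : ℂ) * h t) (weilReflect g)) =
      -weilFunctional (weilConv h (weilReflect g)) := by
    rw [weilConv_const_mul_left, weilFunctional_const_mul]
    ring
  rw [hQn, hc1, hc2] at h2
  rw [h1, h2]
  ring

/-- Real-part form of the parallelogram law:
`Re Q(g − h) = 2Re Q(g) + 2Re Q(h) − Re Q(g + h)`. [folklore] -/
theorem energyCauchy_re_weilQuadratic_sub {g h : ℝ → ℂ} (hg : IsWeilTest g)
    (hh : IsWeilTest h) :
    (weilQuadratic (g - h)).re =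
      2 * (weilQuadratic g).re + 2 * (weilQuadratic h).re - (weilQuadratic (g + h)).re := by
  have h1 := congrArg Complex.re (energyCauchy_weilQuadratic_add_add_sub hg hh)
  simp only [Complex.add_re, Complex.mul_re, Complex.re_ofNat, Complex.im_ofNat, zero_mul,
    sub_zero] at h1
  linarith

/-! ### Window supports -/

/-- `tsupport (g − h) ⊆ [-a, a]` for window functions `g, h`. [folklore] -/
theorem energyCauchy_tsupport_sub_subset {g h : ℝ → ℂ} {a : ℝ} (hg : tsupport g ⊆ Icc (-a) a)
    (hh : tsupport h ⊆ Icc (-a) a) : tsupport (g - h) ⊆ Icc (-a) a :=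
  (tsupport_sub g h).trans (union_subset hg hh)

/-- `tsupport (g + h) ⊆ [-a, a]` for window functions `g, h`. [folklore] -/
theorem energyCauchy_tsupport_add_subset {g h : ℝ → ℂ} {a : ℝ} (hg : tsupport g ⊆ Icc (-a) a)
    (hh : tsupport h ⊆ Icc (-a) a) : tsupport (g + h) ⊆ Icc (-a) a :=
  (tsupport_add g h).trans (union_subset hg hh)

/-! ### The parallelogram law in `L²` -/

/-- `∫‖g + h‖² + ∫‖g − h‖² = 2∫‖g‖² + 2∫‖h‖²` in `L²` (the parallelogram law
`parallelogram_law_with_norm` pointwise). [folklore] -/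
theorem energyCauchy_integral_norm_sq_add_add_sub {g h : ℝ → ℂ} (hg : MemLp g 2)
    (hh : MemLp h 2) :
    (∫ t, ‖g t + h t‖ ^ 2) + ∫ t, ‖g t - h t‖ ^ 2 =
      2 * (∫ t, ‖g t‖ ^ 2) + 2 * ∫ t, ‖h t‖ ^ 2 := by
  have hi1 : Integrable fun t ↦ ‖g t‖ ^ 2 := integrable_norm_sq_of_memLp hg
  have hi2 : Integrable fun t ↦ ‖h t‖ ^ 2 := integrable_norm_sq_of_memLp hh
  have hiS : Integrable fun t ↦ ‖g t + h t‖ ^ 2 := integrable_norm_sq_of_memLp (hg.add hh)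
  have hiD : Integrable fun t ↦ ‖g t - h t‖ ^ 2 := integrable_norm_sq_of_memLp (hg.sub hh)
  rw [← integral_add hiS hiD, ← integral_const_mul, ← integral_const_mul,
    ← integral_add (hi1.const_mul _) (hi2.const_mul _)]
  refine integral_congr_ae (Eventually.of_forall fun t ↦ ?_)
  have hpar := parallelogram_law_with_norm ℂ (g t) (h t)
  simp only [sq]
  linarith

/-! ### The stub -/

/-- **Stub W3 — minimising sequences of a ground state are Cauchy in energy.**  If `gₙ` are
`L²`-normalised window test functions with `Re Q(gₙ) → ε(a)` and `gₙ → u` in `L²`, then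
`Re Q(gₙ − gₘ) → 0` as `n, m → ∞`: by the parallelogram law for `Q`, the Rayleigh bounds
`ε ∫‖gₙ ± gₘ‖² ≤ Re Q(gₙ ± gₘ)`, `∫‖gₙ + gₘ‖² + ∫‖gₙ − gₘ‖² = 4` and
`‖gₙ − gₘ‖₂ ≤ ‖gₙ − u‖₂ + ‖gₘ − u‖₂ → 0`, one has
`ε ∫‖gₙ − gₘ‖² ≤ Re Q(gₙ − gₘ) ≤ 2Re Q(gₙ) + 2Re Q(gₘ) − ε(4 − ∫‖gₙ − gₘ‖²)`, and both bounds
tend to `0`. [folklore] -/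
theorem stub_energyCauchy :
    ∀ (a : ℝ) (u : ℝ → ℂ) (g : ℕ → ℝ → ℂ), MemLp u 2 →
      (∀ n, IsWeilTest (g n) ∧ tsupport (g n) ⊆ Icc (-a) a ∧ ∫ t, ‖g n t‖ ^ 2 = (1 : ℝ)) →
      Tendsto (fun n => (weilQuadratic (g n)).re) atTop (𝓝 (weilGroundEnergy a)) →
      Tendsto (fun n => ∫ t, ‖g n t - u t‖ ^ 2) atTop (𝓝 0) →
      Tendsto (fun p : ℕ × ℕ => (weilQuadratic (g p.1 - g p.2)).re) atTop (𝓝 0) := by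
  intro a u g hu hg hQ hL
  set ε : ℝ := weilGroundEnergy a with hε
  have hgm : ∀ n, MemLp (g n) 2 := fun n ↦
    (hg n).1.1.continuous.memLp_of_hasCompactSupport (hg n).1.2
  -- the product filter `atTop` on `ℕ × ℕ`
  have hfst : Tendsto (Prod.fst : ℕ × ℕ → ℕ) atTop atTop := by
    rw [← prod_atTop_atTop_eq]
    exact tendsto_fst
  have hsnd : Tendsto (Prod.snd : ℕ × ℕ → ℕ) atTop atTop := by
    rw [← prod_atTop_atTop_eq]
    exact tendsto_snd
  -- `∫‖gₙ - gₘ‖² → 0` (Minkowski: `‖gₙ - gₘ‖₂ ≤ ‖gₙ - u‖₂ + ‖gₘ - u‖₂ → 0`)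
  have hD : Tendsto (fun p : ℕ × ℕ ↦ ∫ t, ‖g p.1 t - g p.2 t‖ ^ 2) atTop (𝓝 0) := by
    have hsq : ∀ p : ℕ × ℕ, Real.sqrt (∫ t, ‖g p.1 t - g p.2 t‖ ^ 2) ≤
        Real.sqrt (∫ t, ‖g p.1 t - u t‖ ^ 2) + Real.sqrt (∫ t, ‖g p.2 t - u t‖ ^ 2) := by
      intro p
      have h1 := sqrt_integral_norm_sq_sub_le (f := fun t ↦ g p.1 t - u t)
        (h := fun t ↦ g p.2 t - u t) ((hgm p.1).sub hu) ((hgm p.2).sub hu)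
      simpa only [sub_sub_sub_cancel_right] using h1
    have hA1 : Tendsto (fun p : ℕ × ℕ ↦ ∫ t, ‖g p.1 t - u t‖ ^ 2) atTop (𝓝 0) := hL.comp hfst
    have hA2 : Tendsto (fun p : ℕ × ℕ ↦ ∫ t, ‖g p.2 t - u t‖ ^ 2) atTop (𝓝 0) := hL.comp hsnd
    have h0 : Tendsto (fun p : ℕ × ℕ ↦ Real.sqrt (∫ t, ‖g p.1 t - u t‖ ^ 2) +
        Real.sqrt (∫ t, ‖g p.2 t - u t‖ ^ 2)) atTop (𝓝 0) := by
      simpa using hA1.sqrt.add hA2.sqrt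
    have h1 : Tendsto (fun p : ℕ × ℕ ↦ Real.sqrt (∫ t, ‖g p.1 t - g p.2 t‖ ^ 2)) atTop (𝓝 0) :=
      squeeze_zero (fun p ↦ Real.sqrt_nonneg _) hsq h0
    have h2 := h1.pow 2
    rw [zero_pow two_ne_zero] at h2
    exact h2.congr fun p ↦ Real.sq_sqrt (integral_nonneg fun _ ↦ by positivity)
  -- `∫‖gₙ + gₘ‖² = 4 - ∫‖gₙ - gₘ‖²`
  have hS : ∀ p : ℕ × ℕ, (∫ t, ‖g p.1 t + g p.2 t‖ ^ 2) = 4 - ∫ t, ‖g p.1 t - g p.2 t‖ ^ 2 := by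
    intro p
    have h1 := energyCauchy_integral_norm_sq_add_add_sub (hgm p.1) (hgm p.2)
    rw [(hg p.1).2.2, (hg p.2).2.2] at h1
    linarith
  -- the two Rayleigh bounds
  have hlow : ∀ p : ℕ × ℕ,
      ε * (∫ t, ‖g p.1 t - g p.2 t‖ ^ 2) ≤ (weilQuadratic (g p.1 - g p.2)).re := by
    intro p
    have h1 := weilGroundEnergy_mul_integral_norm_sq_le ((hg p.1).1.sub (hg p.2).1)
      (energyCauchy_tsupport_sub_subset (hg p.1).2.1 (hg p.2).2.1)
    simpa only [Pi.sub_apply] using h1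
  have hupp : ∀ p : ℕ × ℕ, (weilQuadratic (g p.1 - g p.2)).re ≤
      2 * (weilQuadratic (g p.1)).re + 2 * (weilQuadratic (g p.2)).re -
        ε * (4 - ∫ t, ‖g p.1 t - g p.2 t‖ ^ 2) := by
    intro p
    have h1 := weilGroundEnergy_mul_integral_norm_sq_le ((hg p.1).1.add (hg p.2).1)
      (energyCauchy_tsupport_add_subset (hg p.1).2.1 (hg p.2).2.1)
    simp only [Pi.add_apply] at h1
    rw [hS p] at h1
    have h2 := energyCauchy_re_weilQuadratic_sub (hg p.1).1 (hg p.2).1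
    linarith
  -- squeeze
  have hQ1 : Tendsto (fun p : ℕ × ℕ ↦ (weilQuadratic (g p.1)).re) atTop (𝓝 ε) := hQ.comp hfst
  have hQ2 : Tendsto (fun p : ℕ × ℕ ↦ (weilQuadratic (g p.2)).re) atTop (𝓝 ε) := hQ.comp hsnd
  have hlo : Tendsto (fun p : ℕ × ℕ ↦ ε * ∫ t, ‖g p.1 t - g p.2 t‖ ^ 2) atTop (𝓝 0) := by
    have := hD.const_mul ε
    rwa [mul_zero] at this
  have hup : Tendsto (fun p : ℕ × ℕ ↦ 2 * (weilQuadratic (g p.1)).re +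
      2 * (weilQuadratic (g p.2)).re - ε * (4 - ∫ t, ‖g p.1 t - g p.2 t‖ ^ 2)) atTop (𝓝 0) := by
    have h4 : Tendsto (fun p : ℕ × ℕ ↦ ε * (4 - ∫ t, ‖g p.1 t - g p.2 t‖ ^ 2)) atTop
        (𝓝 (ε * (4 - 0))) :=
      tendsto_const_nhds.mul (tendsto_const_nhds.sub hD)
    have h := ((hQ1.const_mul 2).add (hQ2.const_mul 2)).sub h4
    convert h using 2
    ring
  exact tendsto_of_tendsto_of_tendsto_of_le_of_le hlo hup hlow hupp

end Summit.RiemannHypothesis.RiemannHypothesis.Theorems.GroundStatesConvergeToXi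

end
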